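import Summits.Ventures.Crystal3D.Theorems.StickyWulffConstantCoaxialWallLawSeamThreePayerSplitE1
import Summits.Ventures.Crystal3D.Theorems.StickyWulffConstantCoaxialWallLawSeamSatCensusTwelve
import HarnessLib

/-!
# By-name closers: the deg-12 census pieces `SatCensus12Narrow` / `SatCensus12Glide` from GAP(5/2) and the ONE-FREE-PAIR kissing classification (certificate C1)
# (crux `CoaxialWallLaw`, stmt-Ventures-19481; lane F 'Certificates' v8.6, registered stubs `stub_satCensus12Narrow`, `stub_satCensus12Glide`)

HONEST FRAMING. Venture `Summits/Ventures/Crystal3D` (cell `crystal3d-full`); helper for the two deg-12 census stubs.  Nothing new is proved: '…SeamSatCensusTwelve'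
(p741052, 19481-p2 g14) reduces `SatCensus12` to `KissingGap (5/2)` + the certificate-shaped named input `KissingClassificationOneFree (5/2)` (C1: every twelve-point
configuration on `S²(2)` with pairwise distances `2` or `≥ 5/2` except possibly ONE pair is fcc/hcp-arranged; numerics 20 000 multistarts clean; structure theorem
'…SeamSatCensusTwelveOneFreeStructure' by 19481-p1 g21), and '…SeamThreePayerSplitE1' (p742548) splits `SatCensus12` into the NARROW and GLIDE pieces.  This file only
composes them in the exact shape of a DERIVED stub, so that — in the pattern of v8.6's `stub_satCensus11Full` — the planner may register ONE certificate stub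
`stub_oneFree : TailResidue.KissingClassificationOneFree (5/2)` and derive
`stub_satCensus12Narrow := TailResidue.satCensus12Narrow_of_oneFree stub_gap stub_oneFree`, `stub_satCensus12Glide := TailResidue.satCensus12Glide_of_oneFree stub_gap stub_oneFree`.
WHAT THIS IS NOT: C1 is NOT proved; F-C1 not moved.
-/

noncomputable section

namespace Summit.Ventures.Crystal3D.Theorems

namespace TailResidue

open Summit.Ventures.Crystal3D

/-- **`SatCensus12Narrow` from GAP(5/2) and the one-free-pair classification.** -/
theorem satCensus12Narrow_of_oneFree (hg : KissingGap (5 / 2)) (hc : KissingClassificationOneFree (5 / 2)) : SatCensus12Narrow :=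
  (satCensus12Kinds_of_satCensus12 (satCensus12_of_oneFree hg hc)).1

/-- **`SatCensus12Glide` from GAP(5/2) and the one-free-pair classification.** -/
theorem satCensus12Glide_of_oneFree (hg : KissingGap (5 / 2)) (hc : KissingClassificationOneFree (5 / 2)) : SatCensus12Glide :=
  (satCensus12Kinds_of_satCensus12 (satCensus12_of_oneFree hg hc)).2

end TailResidue

end Summit.Ventures.Crystal3D.Theorems

end
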